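import Summits.BirchSwinnertonDyer.Rank1Residual.AdditivePotMult.ModelFree
import Summits.BirchSwinnertonDyer.BirchSwinnertonDyer.Theorems.SchneiderFreeUpperSockets
import Literature.NumberTheory.EllipticCurves.Rank1Residual.Typed.JointLower
import HarnessLib

/-!
# Route ByReductionTypeAtTwo, crux `RankOneAtTwoBigImageOddLocal` (stmt-BirchSwinnertonDyer-23715), LINE v8.6 `one_door_analytic`:
# the halves in JOINT (pair) currency — the `2`-adic BSD defects of `W`, `Wd` and `W ⊗ K` ADD, so each half needs no rank-`0` input

Width prover seat `bsd-line-fkl-p2` g9 (2026-08-28), `--supports stmt-BirchSwinnertonDyer-23715`.  THEOREMS ONLY; nothing is asserted;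
BSD is not proved by any of this.  Sequel of the g8 halves layer (`…OneDoorHalvesK{,Slice,Lossless,Named}.lean`, `…OneDoorPairParity.lean`).

Up to now every K→E transfer of the halves spends FULL `BSD(Wd, 2)` of the rank-`0` twin (`AdditivePotMult.missingUpper/LowerBoundAt_iff_overC`,
g8's `missingUpper/LowerBoundAt_of_upper/lowerOverC_baseChange`), and the named halves U = `DoorIndexLawUpperCAtTwo` / L =
`DoorIndexLawLowerCAtTwo` are tied to the K-side one-sided binders only «modulo PRINT + `S_rankZeroTwin`» (`…OneDoorHalvesKNamed.lean`).  The
point of this file: by the identity `(★)` `#Ш_an(W_K)·#Ш(W)·#Ш(Wd) = #Ш_an(W)·#Ш_an(Wd)·#Ш(W_K)` (`AdditivePotMult.shaAnOverC_mul_eq`, Artin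
formalism + Milne 1972, NO BSD input) the `p`-adic defects `ord_p #Ш_an − ord_p #Ш` of `W`, `Wd`, `W_K` satisfy
`def(W_K) = def(W) + def(Wd)` (`padicValRat_defectC_eq_add`), whence

* §1 (this file; any `p`, any `K`-model `V` of `W_K`, Milne's any-model identity `hWR`, the three `Ш` finite): the over-`K` halves are
  EXACTLY the JOINT halves of the pair — `AdditivePotMult.MissingUpperBoundOverCAt V p ⟺ SchneiderFree.Upper.JointUpperBoundAt W Wd p`
  (`ord_p #Ш(W) + ord_p #Ш(Wd) ≤ ord_p #Ш_an(W) + ord_p #Ш_an(Wd)`) and `MissingLowerBoundOverCAt V p ⟺ Typed.JointLowerBoundAt W Wd p`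
  (given a rational `#Ш_an(Wd)` for `⟹`); and the four CROSSINGS — over-`K` UPPER + the twin's LOWER half ⟹ `MissingUpperBoundAt W p`;
  over-`K` LOWER + the twin's UPPER half ⟹ `MissingLowerBoundAt W p`; over-`K` UPPER + `W`'s LOWER ⟹ the TWIN's upper half (Kolyvagin
  over `K` bounds the rank-`0` member too); over-`K` LOWER + `W`'s UPPER ⟹ the twin's lower half; plus the two ascents.
* companion `…OneDoorHalvesJointDoor.lean` (`p = 2`, per door datum, PRINT only): U's inequality at a door datum IS `JointUpperBoundAt W Wd 2`
  and L's IS `JointLowerBoundAt W Wd 2` (pair ledger `pairShaAnLedger_at`); the c-corrected K-binder `ord₂ #Ш(E_K)[2^∞] + 2·v₂(c) ≤ 2·M₀`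
  IS `MissingUpperBoundOverCAt (W ⊗ K) 2`; doors are Kolyvagin-admissible and carry conductor-`1` data.

Reading for the planner-of-record / the pen: the Euler-system half of `BSD₂(W)` (`MissingUpperBoundAt W 2`) costs Kolyvagin's UPPER bound
at `2` over `K` plus ONLY the LOWER (main-conjecture) half of rank-`0` `BSD₂` of the twin; the main-conjecture half of `BSD₂(W)` costs the
K-side LOWER bound plus ONLY the UPPER (Kato / Euler-system) half of the twin; and the named halves U / L of the line themselves need NO
rank-`0` input at all (sequel `…OneDoorHalvesJointSlice.lean`: U ⟺ hXU and L ⟺ hXL modulo PRINT alone).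

References: [Milne1972ArithmeticAV] §1 Thm. 1; [GrossZagier1986] Thm. I.6.3, V.§2; [GrossLMS1991] Thm. 1.3, §2 Conj. (2.2), §4;
[McCallumLMS1991] §5 Lemma 5.1; [Kramer1981] Prop. 3; [Miller2011LMS] Def. 1.1; [JetchevSkinnerWan2017] §7.4.1.
-/

set_option autoImplicit false
-- the Theorems namespace of this sub repeats the summit name by design (D-0017 nested layout)
set_option linter.dupNamespace false

noncomputable section

open scoped Classical

namespace Summit.BirchSwinnertonDyer.BirchSwinnertonDyer.Theorems.RankOneAtTwoOneDoor

open WeierstrassCurve NumberField Literature.NumberTheory.EllipticCurves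
  Literature.NumberTheory.EllipticCurves.Rank1Residual
  Literature.NumberTheory.EllipticCurves.Rank1Residual.Typed
  Summit.BirchSwinnertonDyer.Rank1Residual.AdditivePotMult
  Summit.BirchSwinnertonDyer.BirchSwinnertonDyer.Theorems.SchneiderFree.Upper

/-! ### §1 The defects add: over-`K` halves = JOINT halves of the pair; the crossings (any prime, any `K`-model) -/

section Generic

variable (W : WeierstrassCurve ℚ) [W.IsElliptic] (p : ℕ) [Fact p.Prime]
  (K : Type) [Field K] [NumberField K]
  (Wd : WeierstrassCurve ℚ) [Wd.IsElliptic] (V : WeierstrassCurve K) [V.IsElliptic]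
  (hmod : hasEntireLFunction_rat) (h2 : Module.finrank ℚ K = 2)
  (hWd : ∃ C : VariableChange ℚ, C • W.quadraticTwist (NumberField.discr K : ℚ) = Wd)
  (hV : ∃ C : VariableChange K, C • W.baseChange K = V)
  (hshaW : W.ShaFinite) (hshaD : Wd.ShaFinite) (hshaK : V.ShaFinite)
  (hWR : (V.shaOrder : ℝ) * V.regulator * V.bsdPeriod * (V.modifiedTamagawaProduct : ℝ) /
      (V.torsionOrder : ℝ) ^ 2 = W.bsdRHS * Wd.bsdRHS)

include hmod h2 hWd hV hshaW hshaD hshaK hWR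

/-- **The `p`-adic BSD defects ADD along a quadratic base change** (any `p`, any `K`-model `V` of `W_K`, `Wd` a `ℚ`-model of
`W^{(d_K)}`, the three `Ш` finite, Milne's any-model Weil-restriction identity `hWR`): for rational values `q`, `q_d`, `q'` of
`#Ш_an(W)`, `#Ш_an(Wd)`, `#Ш_an(V)`, `(ord_p q' − ord_p #Ш(V)) = (ord_p q − ord_p #Ш(W)) + (ord_p q_d − ord_p #Ш(Wd))`.  Valuations of
`(★)` `q'·#Ш(W)·#Ш(Wd) = q·q_d·#Ш(V)` (`shaAnOverC_mul_eq`); no BSD input (`AdditivePotMult.padicValRat_defectC_eq` is the case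
`def(Wd) = 0`). [cite: Milne1972ArithmeticAV, §1 Thm. 1] -/
theorem padicValRat_defectC_eq_add {q qd q' : ℚ} (hq : shaAn W = (q : ℂ)) (hqd : shaAn Wd = (qd : ℂ))
    (hq' : shaAnOverC V = (q' : ℂ)) :
    padicValRat p q' - padicValNat p V.shaOrder =
      (padicValRat p q - padicValNat p W.shaOrder) + (padicValRat p qd - padicValNat p Wd.shaOrder) := by
  have hstar := shaAnOverC_mul_eq W K Wd V hmod h2 hWd hV hshaW hshaD hWR
  have hsW : W.shaOrder ≠ 0 := (W.shaOrder_pos hshaW).ne'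
  have hsD : Wd.shaOrder ≠ 0 := (Wd.shaOrder_pos hshaD).ne'
  have hsK : V.shaOrder ≠ 0 := (V.shaOrder_pos hshaK).ne'
  have hq0 : q ≠ 0 := by
    intro h0; apply shaAn_ne_zero W hmod; rw [hq, h0, Rat.cast_zero]
  have hqd0 : qd ≠ 0 := by
    intro h0; apply shaAn_ne_zero Wd hmod; rw [hqd, h0, Rat.cast_zero]
  have hQ : q' * W.shaOrder * Wd.shaOrder = q * qd * V.shaOrder := by
    have h : ((q' * W.shaOrder * Wd.shaOrder : ℚ) : ℂ) = ((q * qd * V.shaOrder : ℚ) : ℂ) := by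
      push_cast
      rw [← hq, ← hq', ← hqd]
      exact hstar
    exact_mod_cast h
  have hsKq : (V.shaOrder : ℚ) ≠ 0 := by exact_mod_cast hsK
  have hsWq : (W.shaOrder : ℚ) ≠ 0 := by exact_mod_cast hsW
  have hsDq : (Wd.shaOrder : ℚ) ≠ 0 := by exact_mod_cast hsD
  have hq'0 : q' ≠ 0 := by
    intro h0
    rw [h0, zero_mul, zero_mul] at hQ
    exact mul_ne_zero (mul_ne_zero hq0 hqd0) hsKq hQ.symm
  have hv := congrArg (padicValRat p) hQ
  rw [padicValRat.mul (mul_ne_zero hq'0 hsWq) hsDq, padicValRat.mul hq'0 hsWq,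
    padicValRat.mul (mul_ne_zero hq0 hqd0) hsKq, padicValRat.mul hq0 hqd0,
    padicValRat.of_nat, padicValRat.of_nat, padicValRat.of_nat] at hv
  push_cast at hv ⊢
  linarith

/-- **JOINT upper half of the pair ⟹ the UPPER half over `K`** (any `p`; `(★)`). [cite: Milne1972ArithmeticAV, §1 Thm. 1] -/
theorem upperOverC_of_jointUpperBoundAt (hJ : JointUpperBoundAt W Wd p) : MissingUpperBoundOverCAt V p := by
  obtain ⟨q, qd, hq, hqd, hle⟩ := hJ
  have hq' := exists_shaAnOverC_eq_of_rat W K Wd V hmod h2 hWd hV hshaW hshaD hWR hq hqd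
  refine ⟨_, hq', ?_⟩
  have := padicValRat_defectC_eq_add W p K Wd V hmod h2 hWd hV hshaW hshaD hshaK hWR hq hqd hq'
  linarith

/-- **The UPPER half over `K` ⟹ the JOINT upper half of the pair**, given a rational value of `#Ш_an(Wd)` (rank `0`: modular symbols;
rank `1`: Gross–Zagier). [cite: Milne1972ArithmeticAV, §1 Thm. 1] -/
theorem jointUpperBoundAt_of_upperOverC (hKU : MissingUpperBoundOverCAt V p) (hrat : ∃ qd : ℚ, shaAn Wd = (qd : ℂ)) :
    JointUpperBoundAt W Wd p := by
  obtain ⟨q', hq', hle⟩ := hKU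
  obtain ⟨qd, hqd⟩ := hrat
  have hq := exists_shaAn_eq_of_overC W K Wd V hmod h2 hWd hV hshaW hshaD hshaK hWR hq' hqd
  refine ⟨_, qd, hq, hqd, ?_⟩
  have := padicValRat_defectC_eq_add W p K Wd V hmod h2 hWd hV hshaW hshaD hshaK hWR hq hqd hq'
  linarith

/-- **JOINT lower half of the pair ⟹ the LOWER half over `K`** (any `p`; `(★)`). [cite: Milne1972ArithmeticAV, §1 Thm. 1] -/
theorem lowerOverC_of_jointLowerBoundAt (hJ : JointLowerBoundAt W Wd p) : MissingLowerBoundOverCAt V p := by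
  obtain ⟨q, qd, hq, hqd, hle⟩ := hJ
  have hq' := exists_shaAnOverC_eq_of_rat W K Wd V hmod h2 hWd hV hshaW hshaD hWR hq hqd
  refine ⟨_, hq', ?_⟩
  have := padicValRat_defectC_eq_add W p K Wd V hmod h2 hWd hV hshaW hshaD hshaK hWR hq hqd hq'
  linarith

/-- **The LOWER half over `K` ⟹ the JOINT lower half of the pair**, given a rational value of `#Ш_an(Wd)`.
[cite: Milne1972ArithmeticAV, §1 Thm. 1] -/
theorem jointLowerBoundAt_of_lowerOverC (hKL : MissingLowerBoundOverCAt V p) (hrat : ∃ qd : ℚ, shaAn Wd = (qd : ℂ)) :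
    JointLowerBoundAt W Wd p := by
  obtain ⟨q', hq', hle⟩ := hKL
  obtain ⟨qd, hqd⟩ := hrat
  have hq := exists_shaAn_eq_of_overC W K Wd V hmod h2 hWd hV hshaW hshaD hshaK hWR hq' hqd
  refine ⟨_, qd, hq, hqd, ?_⟩
  have := padicValRat_defectC_eq_add W p K Wd V hmod h2 hWd hV hshaW hshaD hshaK hWR hq hqd hq'
  linarith

/-- **Over-`K` upper ⟺ JOINT upper** (given a rational `#Ш_an(Wd)`). [cite: Milne1972ArithmeticAV, §1 Thm. 1] -/
theorem upperOverC_iff_jointUpperBoundAt (hrat : ∃ qd : ℚ, shaAn Wd = (qd : ℂ)) :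
    MissingUpperBoundOverCAt V p ↔ JointUpperBoundAt W Wd p :=
  ⟨fun h => jointUpperBoundAt_of_upperOverC W p K Wd V hmod h2 hWd hV hshaW hshaD hshaK hWR h hrat,
    upperOverC_of_jointUpperBoundAt W p K Wd V hmod h2 hWd hV hshaW hshaD hshaK hWR⟩

/-- **Over-`K` lower ⟺ JOINT lower** (given a rational `#Ш_an(Wd)`). [cite: Milne1972ArithmeticAV, §1 Thm. 1] -/
theorem lowerOverC_iff_jointLowerBoundAt (hrat : ∃ qd : ℚ, shaAn Wd = (qd : ℂ)) :
    MissingLowerBoundOverCAt V p ↔ JointLowerBoundAt W Wd p :=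
  ⟨fun h => jointLowerBoundAt_of_lowerOverC W p K Wd V hmod h2 hWd hV hshaW hshaD hshaK hWR h hrat,
    lowerOverC_of_jointLowerBoundAt W p K Wd V hmod h2 hWd hV hshaW hshaD hshaK hWR⟩

/-- **CROSSING 1: over-`K` UPPER + the twin's LOWER half ⟹ the UPPER half of `W`** (`def(W) = def(W_K) − def(Wd) ≤ 0`).  The rank-`0`
input of the Euler-system half is the twin's MAIN-CONJECTURE half only. [cite: Milne1972ArithmeticAV, §1 Thm. 1] [cite: Miller2011LMS, Def. 1.1] -/
theorem missingUpperBoundAt_of_upperOverC_of_missingLowerBoundAt_twin (hKU : MissingUpperBoundOverCAt V p)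
    (hL : MissingLowerBoundAt Wd p) : MissingUpperBoundAt W p := by
  obtain ⟨qd, hqd, -⟩ := id hL
  exact missingUpperBoundAt_of_jointUpper_of_lower
    (jointUpperBoundAt_of_upperOverC W p K Wd V hmod h2 hWd hV hshaW hshaD hshaK hWR hKU ⟨qd, hqd⟩) hL

/-- **CROSSING 2: over-`K` LOWER + the twin's UPPER half ⟹ the LOWER half of `W`** (`def(W) = def(W_K) − def(Wd) ≥ 0`).  The rank-`0`
input of the main-conjecture half is the twin's EULER-SYSTEM (Kato) half only. [cite: Milne1972ArithmeticAV, §1 Thm. 1] [cite: Miller2011LMS, Def. 1.1] -/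
theorem missingLowerBoundAt_of_lowerOverC_of_missingUpperBoundAt_twin (hKL : MissingLowerBoundOverCAt V p)
    (hU : MissingUpperBoundAt Wd p) : MissingLowerBoundAt W p := by
  obtain ⟨qd, hqd, -⟩ := id hU
  exact missingLowerBoundAt_of_joint_of_upper
    (jointLowerBoundAt_of_lowerOverC W p K Wd V hmod h2 hWd hV hshaW hshaD hshaK hWR hKL ⟨qd, hqd⟩) hU

/-- **CROSSING 3: over-`K` UPPER + `W`'s LOWER half ⟹ the TWIN's upper half** — Kolyvagin's bound over `K` also bounds the rank-`0`
member. [cite: Milne1972ArithmeticAV, §1 Thm. 1] [cite: Miller2011LMS, Def. 1.1] -/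
theorem missingUpperBoundAt_twin_of_upperOverC_of_missingLowerBoundAt (hKU : MissingUpperBoundOverCAt V p)
    (hrat : ∃ qd : ℚ, shaAn Wd = (qd : ℂ)) (hL : MissingLowerBoundAt W p) : MissingUpperBoundAt Wd p := by
  obtain ⟨q, qd, hq, hqd, hle⟩ := jointUpperBoundAt_of_upperOverC W p K Wd V hmod h2 hWd hV hshaW hshaD hshaK hWR hKU hrat
  obtain ⟨q₁, hq₁, hl⟩ := hL
  have hqq : q₁ = q := by
    have : ((q₁ : ℂ)) = (q : ℂ) := by rw [← hq₁, hq]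
    exact_mod_cast this
  subst hqq
  exact ⟨qd, hqd, by omega⟩

/-- **CROSSING 4: over-`K` LOWER + `W`'s UPPER half ⟹ the TWIN's lower half.** [cite: Milne1972ArithmeticAV, §1 Thm. 1]
[cite: Miller2011LMS, Def. 1.1] -/
theorem missingLowerBoundAt_twin_of_lowerOverC_of_missingUpperBoundAt (hKL : MissingLowerBoundOverCAt V p)
    (hrat : ∃ qd : ℚ, shaAn Wd = (qd : ℂ)) (hU : MissingUpperBoundAt W p) : MissingLowerBoundAt Wd p := by
  obtain ⟨q, qd, hq, hqd, hle⟩ := jointLowerBoundAt_of_lowerOverC W p K Wd V hmod h2 hWd hV hshaW hshaD hshaK hWR hKL hrat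
  obtain ⟨q₁, hq₁, hu⟩ := hU
  have hqq : q₁ = q := by
    have : ((q₁ : ℂ)) = (q : ℂ) := by rw [← hq₁, hq]
    exact_mod_cast this
  subst hqq
  exact ⟨qd, hqd, by omega⟩

/-- **Both UPPER halves over `ℚ` ⟹ the UPPER half over `K`** (ascent; `def(W_K) = def(W) + def(Wd)`). [cite: Milne1972ArithmeticAV, §1 Thm. 1] -/
theorem upperOverC_of_missingUpperBoundAt_of_twin (hU : MissingUpperBoundAt W p) (hUd : MissingUpperBoundAt Wd p) :
    MissingUpperBoundOverCAt V p :=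
  upperOverC_of_jointUpperBoundAt W p K Wd V hmod h2 hWd hV hshaW hshaD hshaK hWR (jointUpper_of_upper_of_upper hU hUd)

/-- **Both LOWER halves over `ℚ` ⟹ the LOWER half over `K`.** [cite: Milne1972ArithmeticAV, §1 Thm. 1] -/
theorem lowerOverC_of_missingLowerBoundAt_of_twin (hL : MissingLowerBoundAt W p) (hLd : MissingLowerBoundAt Wd p) :
    MissingLowerBoundOverCAt V p :=
  lowerOverC_of_jointLowerBoundAt W p K Wd V hmod h2 hWd hV hshaW hshaD hshaK hWR (joint_of_lower_of_lower hL hLd)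

end Generic

/-! ### §1b Joint upper ∧ joint lower: the pair's defects are OPPOSITE, so `BSD_p` of one member ⟺ `BSD_p` of the other -/

/-- **JOINT UPPER ∧ JOINT LOWER ⟹ `MissingPPartAt W p ↔ MissingPPartAt Wd p`** (pure bookkeeping on Miller's currency: the two joint halves
say `def(W) + def(Wd) = 0`, so one defect vanishes iff the other does).  Reading on the one-door line: modulo U ∧ L (= Kolyvagin exactness at
`2` over `K`), the `2`-part of BSD of the rank-ONE curve is EQUIVALENT to the `2`-part of BSD of ANY ONE of its rank-ZERO door twins.
[cite: Miller2011LMS, Def. 1.1] -/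
theorem missingPPartAt_iff_twin_of_jointUpper_of_jointLower {W Wd : WeierstrassCurve ℚ} {p : ℕ}
    (hJU : JointUpperBoundAt W Wd p) (hJL : JointLowerBoundAt W Wd p) :
    MissingPPartAt W p ↔ MissingPPartAt Wd p := by
  obtain ⟨q, qd, hq, hqd, heq⟩ := sha_sum_eq_of_jointLower_of_jointUpper hJL hJU
  constructor
  · rintro ⟨q₁, hq₁, hv⟩
    have h1 : q₁ = q := by
      have : ((q₁ : ℂ)) = (q : ℂ) := by rw [← hq₁, hq]
      exact_mod_cast this
    subst h1
    exact ⟨qd, hqd, by omega⟩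
  · rintro ⟨q₁, hq₁, hv⟩
    have h1 : q₁ = qd := by
      have : ((q₁ : ℂ)) = (qd : ℂ) := by rw [← hq₁, hqd]
      exact_mod_cast this
    subst h1
    exact ⟨q, hq, by omega⟩

/-- **JOINT UPPER ∧ JOINT LOWER ⟹ `BSD(W,p) ↔ BSD(Wd,p)`** for `W`, `Wd` of analytic rank `≤ 1` (GZK for the rank part and finiteness).
[cite: Miller2011LMS, §1 and Def. 1.1] -/
theorem bsdp_iff_twin_of_jointUpper_of_jointLower {W Wd : WeierstrassCurve ℚ} [W.IsElliptic] [Wd.IsElliptic] {p : ℕ} [Fact p.Prime]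
    (hGZK : rank_eq_analyticRank_of_analyticRank_le_one) (hr : W.analyticRank ≤ 1) (hrd : Wd.analyticRank ≤ 1)
    (hJU : JointUpperBoundAt W Wd p) (hJL : JointLowerBoundAt W Wd p) :
    BSDp W p ↔ BSDp Wd p := by
  haveI : Finite W.sha := (hGZK W hr).2
  haveI : Finite Wd.sha := (hGZK Wd hrd).2
  constructor
  · intro h
    exact bsdp_of_missingPPartAt Wd p hGZK hrd
      ((missingPPartAt_iff_twin_of_jointUpper_of_jointLower hJU hJL).mp (missingPPartAt_of_bsdp W p h))
  · intro h
    exact bsdp_of_missingPPartAt W p hGZK hr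
      ((missingPPartAt_iff_twin_of_jointUpper_of_jointLower hJU hJL).mpr (missingPPartAt_of_bsdp Wd p h))

end Summit.BirchSwinnertonDyer.BirchSwinnertonDyer.Theorems.RankOneAtTwoOneDoor

end
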